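import Summits.BirchSwinnertonDyer.BirchSwinnertonDyer.Theorems.PrintCf2RubinValueTwoFrameSeedFrameUnique
import HarnessLib

/-!
# The v11 crux `RubinValueFormulaAtTwoV11` (stmt-24034) follows BY NAME from the v10 aside `RubinValueFormulaAtTwo` (stmt-23721),
# hence from the v10 research kernel R alone
# (crux `stmt-BirchSwinnertonDyer-24034` `PrintCf2RubinValueTwo.RubinValueFormulaAtTwoV11`, line `value-transport-v11` — bookkeeping)

Cell `bsd-print-cf2`, seat `cruxlead-23721` g3 (re-keyed LEAD of 24034).  `--supports` 24034; no definitions.  Route C rev 8 re-cut S2′: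
the live crux `RubinValueFormulaAtTwoV11` is the v10 text with FOUR extra antecedents (adapted pair, framed quadratic `θ` with Hecke avatar,
S3a's characteristic-ideal clause for the frame's own `G₂`) and the identical conclusion (referee vet g12: `v11_of_v10`, scratch only).

* **`rubinValueFormulaAtTwoV11_of_v10 : RubinValueFormulaAtTwo → RubinValueFormulaAtTwoV11`** (drop the four antecedents);
* **`rubinValueFormulaAtTwoV11_of_katzValue`** — the v11 crux BY NAME from the v10 research kernel R in existence form alone
  (`FrameSeed.rubinValueFormulaAtTwo_of_katzValue`, which consumes the now unconditional Katz-frame uniqueness U_S2′).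
So ONE research statement (R: on every S2′ frame SOME solution of de Shalit's frame takes the Rubin value) closes both the aside 23721
and the crux 24034; the LEAD skeleton of 24034 (`Cruxes/RubinValueFormulaAtTwoV11/Lines/value_transport_v11.lean`) registers the weaker
R₁₁ (witness carrying the clause; value rigidity instead of uniqueness).

HONEST FRAMING: glue; R / R₁₁ remain open (research, beyond print at the additive split prime 2).  beyond-print theorem: no.
BSD is not proved by any of this.

References: [Rubin1992] Cor. 10.3 (shape); [deShalit1987] II.4.17 (54); [GrossZagier1986] Thm. I.(7.3).
-/

-- the summit namespace `Summit.BirchSwinnertonDyer.BirchSwinnertonDyer` repeats the problem name by design (D-0017)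
set_option linter.dupNamespace false
set_option autoImplicit false

noncomputable section

open scoped Classical

open NumberField IsDedekindDomain Field WeierstrassCurve Literature.NumberTheory.GaloisRepresentations
  Literature.NumberTheory.EllipticCurves Literature.NumberTheory.EllipticCurves.Rank1Residual
  Literature.NumberTheory.EllipticCurves.DeShalit1987

namespace Summit.BirchSwinnertonDyer.BirchSwinnertonDyer.Theorems.PrintCf2.FrameSeed

/-- **v10 ⟹ v11**: the re-cut crux `RubinValueFormulaAtTwoV11` (stmt-24034) follows from the v10 aside `RubinValueFormulaAtTwo`
(stmt-23721) by dropping its four extra antecedents. [cite: Rubin1992, Cor. 10.3 (shape)] -/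
theorem rubinValueFormulaAtTwoV11_of_v10
    (h10 : Summit.BirchSwinnertonDyer.BirchSwinnertonDyer.Theses.PrintCf2RubinValueTwo.RubinValueFormulaAtTwo) :
    Summit.BirchSwinnertonDyer.BirchSwinnertonDyer.Theses.PrintCf2RubinValueTwo.RubinValueFormulaAtTwoV11 := by
  intro hGZ hRk
  obtain ⟨eA, hA⟩ := h10 hGZ hRk
  refine ⟨eA, ?_⟩
  intro d hd0 hsq hd4 W _ _ C hC hr K _ _ hK v vbar hv hvbar hne ι hι c hc ψ hψ hL κ₁ κ₂ γ₁ γ₂ hpair _ θ θK ρ r _ _ hθK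
    hρr hrpair hρ Sθ hvS hvbarS hSram hSunr Ω δ Ωp G₂ hΩ hδ hG₂ _ P c₀ ℓ hP hgen hc₀ hker hlog
  exact hA d hd0 hsq hd4 W C hC hr K hK v vbar hv hvbar hne ι hι c hc ψ hψ hL κ₁ κ₂ γ₁ γ₂ hpair θK ρ r hθK hρr hrpair hρ
    Sθ hvS hvbarS hSram hSunr Ω δ Ωp G₂ hΩ hδ hG₂ P c₀ ℓ hP hgen hc₀ hker hlog

/-- **The v11 crux BY NAME from the v10 research kernel R (existence form) alone.** CONDITIONAL on the displayed `hR`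
(= `stub_katzRubinValue_two` of the v10 line; research). [cite: Rubin1992, Cor. 10.3 (shape)] [cite: deShalit1987, II.4.17 (54)] -/
theorem rubinValueFormulaAtTwoV11_of_katzValue
    (hR :
      GrossZagier1986_thm_I_7_3 → rank_eq_analyticRank_of_analyticRank_le_one →
      ∃ eA : ℤ → ℤ → ℤ,
      ∀ (d : ℤ), d ≠ 0 → Squarefree d → d % 4 ≠ 1 →
      ∀ (W : WeierstrassCurve ℚ) [W.IsElliptic] [W.IsGloballyMinimal] (C : VariableChange ℚ),
      C • W = cm7.quadraticTwist (d : ℚ) → W.analyticRank = 1 →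
      ∀ (K : Type) [Field K] [NumberField K], IsImaginaryQuadratic K →
      ∀ (v vbar : HeightOneSpectrum (𝓞 K)),
      ((2 : ℕ) : 𝓞 K) ∈ v.asIdeal → ((2 : ℕ) : 𝓞 K) ∈ vbar.asIdeal → vbar ≠ v →
      ∀ (ι : PadicAlgCl 2 ≃+* ℂ),
      (∀ (w : InfinitePlace K) (k : 𝓞 K), k ∈ v.asIdeal ↔ ‖ι.symm (w.embedding (k : K))‖ < 1) →
      ∀ (c : K ≃ₐ[ℚ] K), c ≠ 1 →
      ∀ (ψ : HeckeCharacter K), ψ.HasInfinityType (fun _ ↦ 1) (fun _ ↦ 0) →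
      (∀ s : ℂ, 3 / 2 < s.re → heckeLFunction ψ s = W.LSeries s) →
      ∀ (κ₁ κ₂ : ZpExtension K 2) (γ₁ γ₂ : absoluteGaloisGroup K), ZpExtension.IsTopGeneratorPair κ₁ κ₂ γ₁ γ₂ →
      ∀ (θK ρ : HeckeCharacter K) (r : FramedGaloisRep K (PadicAlgCl 2) 1),
      θK * θK = 1 → IsPAdicAvatarOf ι ρ r → FactorsThroughPair κ₁ κ₂ r →
      θK⁻¹ * ρ = (HeckeCharacter.galConj c ψ)⁻¹ →
      ∀ (Sθ : Finset (HeightOneSpectrum (𝓞 K))), v ∉ Sθ → vbar ∉ Sθ →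
      (∀ w ∈ Sθ, ¬ θK.IsUnramifiedAt w) →
      (∀ w : HeightOneSpectrum (𝓞 K), w ∉ Sθ → w ≠ v → w ≠ vbar → θK.IsUnramifiedAt w) →
      ∀ (Ω δ : ℂ) (Ωp : (unrIntegers 2)ˣ) (G₂ : PowerSeries (PowerSeries (PadicComplexInt 2))),
      Ω ≠ 0 → (δ ^ 2 = (NumberField.discr K : ℂ) ∨ δ ^ 2 = -(NumberField.discr K : ℂ)) →
      IsKatzMeasure₂ ι v vbar Sθ κ₁ κ₂ γ₁⁻¹ γ₂⁻¹ θK⁻¹ Ω δ ((Ωp : unrIntegers 2) : ℂ_[2]) G₂ →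
      ∀ (P : W.toAffine.Point) (c₀ : ℕ) (ℓ : ℤ),
      ¬ IsOfFinAddOrder P →
      (∀ R : W.toAffine.Point, ∃ (k : ℤ) (T : W.toAffine.Point), IsOfFinAddOrder T ∧ R = k • P + T) →
      c₀ ≠ 0 → (W.baseChange ℚ_[2]).IsInReductionKernel (c₀ • W.toPadicPoint 2 P) →
      ‖(W.baseChange ℚ_[2]).padicLogPoint (c₀ • W.toPadicPoint 2 P) / (c₀ : ℚ_[2])‖ = (2 : ℝ) ^ (-ℓ) →
      ∀ (q : ℚ), shaAn W = (q : ℂ) →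
      ∃ G₀ : PowerSeries (PowerSeries (PadicComplexInt 2)),
      IsKatzMeasure₂ ι v vbar Sθ κ₁ κ₂ γ₁⁻¹ γ₂⁻¹ θK⁻¹ Ω δ ((Ωp : unrIntegers 2) : ℂ_[2]) G₀ ∧
      ∃ val₀ : ℂ_[2],
      IntSeries.HasValueAt₂ G₀ (avatarValueAt r γ₁⁻¹ - 1) (avatarValueAt r γ₂⁻¹ - 1) val₀ ∧
      ‖val₀‖ = (2 : ℝ) ^ (-((2 * (padicValRat 2 q + (padicValNat 2 W.tamagawaProduct : ℤ)
      - 2 * (padicValNat 2 W.torsionOrder : ℤ) + 2 * ℓ) + eA (d % 2) ((d / (2 - d % 2)) % 8) : ℤ) : ℝ) / 2)) :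
    Summit.BirchSwinnertonDyer.BirchSwinnertonDyer.Theses.PrintCf2RubinValueTwo.RubinValueFormulaAtTwoV11 :=
  rubinValueFormulaAtTwoV11_of_v10 (rubinValueFormulaAtTwo_of_katzValue hR)

end Summit.BirchSwinnertonDyer.BirchSwinnertonDyer.Theorems.PrintCf2.FrameSeed

end
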